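import Literature.Combinatorics.SimpleGraph.TriangleFreeLocalCutLargeDegree
import HarnessLib


/-!
# Shearer's bound: a cut of expected weight `½ + √2/(8√d)` in every `d`-regular triangle-free graph

Sources. [Shearer1992] J. B. Shearer, *A note on bipartite subgraphs of triangle-free graphs*,
Random Structures & Algorithms 3 (1992) 223–226 (paywalled; acquisition acq-10749 open) — the
`d`-regular case as RESTATED in the held secondary [HirvonenRybickiSchmidSuomela2017] = Hirvonen,
Rybicki, Schmid, Suomela, Electron. J. Combin. 24(4) (2017) P4.21 = arXiv:1402.2543, Abstract
(p0001 L34: “Shearer (1992) gives a randomised algorithm that finds a cut of expected size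
`(1/2 + 0.177/√d)m`, where `m` is the number of edges”) and §1.3 (p0002 L25–L48): Shearer's algorithm
— three uniform random cuts `c₁, c₂, c₃`, output `c₁(v)` if `ℓ(v) < d/2`, `c₁(v)` if `ℓ(v) = d/2`
and `c₃(v) = 0`, `c₂(v)` if `ℓ(v) = d/2` and `c₃(v) = 1`, `c₂(v)` if `ℓ(v) > d/2` (eq. (1)) — and
eq. (2): “Shearer shows that the expected weight of cut (1) is at least `½ + √2/(8√d) ≈ ½ +
0.177/√d` in `d`-regular triangle-free graphs.”

The tree already has Shearer's rule in HRSS's one-round model (`shearerRule`, profile `shearerQ =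
1, ½, 0`, `shearerRule_symmetric` in `TriangleFreeLocalCut`), with the note “Shearer's lower bound
`½ + √2/(8√d)` itself is not formalised here”. THIS FILE proves it (0 facts, 0 sorry), by OUR route —
Hastings' exact formula `½ + ¼(A_q² − B_q²)` for spin-symmetric rules (tree) and Wallis' bound on the
central binomial coefficient (`sqrt_le_cbin` of `TriangleFreeLocalCutLargeDegree`) — not Shearer's
original argument (not held):

* `hastings_shearer_odd` / `hastings_shearer_even`: for Shearer's profile `A_q + B_q = 1` and
  `A_q − B_q = 4^{-⌊d/2⌋} C(2⌊d/2⌋, ⌊d/2⌋) = cbin ⌊d/2⌋` (row sums of Pascal's triangle);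
* **`ngraphWeight_shearer`**: the EXACT neighbourhood-graph weight of Shearer's rule is
  `½ + ¼·cbin ⌊d/2⌋`; **`expCutWeight_shearer`** / **`expCutCount_shearer`**: hence the exact expected
  cut weight / count on every `d`-regular triangle-free graph (HRSS Lemma 2);
* **`shearer_const_le`** / **`shearer_bound_le_exact`**: `√2/(8√d) ≤ ¼·cbin ⌊d/2⌋` for every `d ≥ 1`
  (Wallis for `d ≠ 2`; equality at `d = 2`);
* **`shearer_expCutWeight_ge`** / **`shearer_expCutCount_ge`** — the printed statement: expected cut
  weight `≥ ½ + √2/(8√d)`; **`shearer_exists_cut`**: every `d`-regular triangle-free graph, `d ≥ 1`,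
  has a bipartite subgraph with at least `(½ + √2/(8√d))·|E|` edges;
* `shearer_lt_hrss_lt_qaoa`: the printed constants `√2/8 < 9/32 < 0.3032` (Shearer < HRSS Thm 4 <
  QAOA₁).

NOT formalised: Shearer's general degree-sequence form `m/2 + (1/(8√2)) Σ_v √d_v` for arbitrary
triangle-free graphs (TODO(general form)); Shearer's own proof. HONEST FRAMING: instance-level
adjudication of specific advantage claims; no claim about BQP vs BPP or the summit. (Context: the
oldest of the classical one-round baselines that the QAOA₁-on-triangle-free-graphs literature
compares against; see `QAOAVersusThreshold`.)
-/

noncomputable section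

namespace Literature.Combinatorics.SimpleGraph.ShearerTriangleFreeCut

open Finset Real
open Literature.Combinatorics.SimpleGraph.TriangleFreeLocalCut
open Literature.Combinatorics.SimpleGraph.TriangleFreeLocalCutLargeDegree

/-! ## Two row sums of Pascal's triangle -/

/-- Even rows: `2 Σ_{n<k} C(2k, n) + C(2k, k) = 4^k`. [folklore] -/
private theorem two_mul_sum_add_middle (k : ℕ) :
    2 * ∑ n ∈ range k, (2 * k).choose n + (2 * k).choose k = 4 ^ k := by
  have htot : ∑ n ∈ range (2 * k + 1), (2 * k).choose n = 4 ^ k := by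
    rw [Nat.sum_range_choose, pow_mul]; norm_num
  have hsplit : ∑ n ∈ range (2 * k + 1), (2 * k).choose n =
      ∑ n ∈ range k, (2 * k).choose n + (2 * k).choose k +
        ∑ n ∈ Ico (k + 1) (2 * k + 1), (2 * k).choose n := by
    rw [range_eq_Ico, ← sum_Ico_consecutive _ (show 0 ≤ k + 1 by omega) (show k + 1 ≤ 2 * k + 1 by omega),
      ← range_eq_Ico, sum_range_succ]
  have hrefl : ∑ n ∈ Ico (k + 1) (2 * k + 1), (2 * k).choose n = ∑ n ∈ range k, (2 * k).choose n := by
    refine Finset.sum_nbij' (fun n => 2 * k - n) (fun n => 2 * k - n) ?_ ?_ ?_ ?_ ?_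
    · intro n hn; simp only [mem_Ico, mem_range] at hn ⊢; omega
    · intro n hn; simp only [mem_Ico, mem_range] at hn ⊢; omega
    · intro n hn; simp only [mem_Ico] at hn; omega
    · intro n hn; simp only [mem_range] at hn; omega
    · intro n hn
      simp only [mem_Ico] at hn
      rw [Nat.choose_symm (by omega : n ≤ 2 * k)]
  omega

/-! ## Hastings' `A_q`, `B_q` for Shearer's profile `1, ½, 0` -/

/-- Odd degree `d = 2k+1`: `A_q = (Σ_{n≤k} C(2k,n))/4^k`, `B_q = (Σ_{n<k} C(2k,n))/4^k`, hence
`A_q + B_q = 1` and `A_q − B_q = 4^{-k} C(2k,k)`. [cite: HirvonenRybickiSchmidSuomela2017, §1.3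
eq. (1) (Shearer's rule) with §2.4 Lemma 2 / Hastings2019BoundedDepth §3.3 (exact performance of a
spin-symmetric rule)] -/
theorem hastings_shearer_odd (k : ℕ) :
    hastingsA (2 * k + 1) (shearerQ (2 * k + 1)) + hastingsB (2 * k + 1) (shearerQ (2 * k + 1)) = 1 ∧
    hastingsA (2 * k + 1) (shearerQ (2 * k + 1)) - hastingsB (2 * k + 1) (shearerQ (2 * k + 1)) =
      cbin k := by
  have hq : ∀ n, shearerQ (2 * k + 1) n = if n < k + 1 then 1 else 0 := by
    intro n
    unfold shearerQ
    by_cases h : n < k + 1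
    · rw [if_pos (by omega), if_pos h]
    · rw [if_neg (by omega), if_neg (by omega), if_neg h]
  have hA : hastingsA (2 * k + 1) (shearerQ (2 * k + 1)) =
      (∑ n ∈ range (k + 1), ((2 * k).choose n : ℝ)) / 4 ^ k := by
    unfold hastingsA
    rw [show 2 * k + 1 - 1 = 2 * k by omega, pow_mul, show ((2 : ℝ) ^ 2) = 4 by norm_num]
    congr 1
    simp_rw [hq, mul_ite, mul_one, mul_zero]
    rw [← sum_filter]
    congr 1
    ext n; simp only [mem_filter, mem_range]; omega
  have hB : hastingsB (2 * k + 1) (shearerQ (2 * k + 1)) =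
      (∑ n ∈ range k, ((2 * k).choose n : ℝ)) / 4 ^ k := by
    unfold hastingsB
    rw [show 2 * k + 1 - 1 = 2 * k by omega, pow_mul, show ((2 : ℝ) ^ 2) = 4 by norm_num]
    congr 1
    simp_rw [hq, mul_ite, mul_one, mul_zero]
    rw [← sum_filter]
    congr 1
    ext n; simp only [mem_filter, mem_range]; omega
  have hid : (2 : ℝ) * ∑ n ∈ range k, ((2 * k).choose n : ℝ) + ((2 * k).choose k : ℝ) = 4 ^ k := by
    exact_mod_cast two_mul_sum_add_middle k
  have h4 : (0 : ℝ) < 4 ^ k := by positivity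
  rw [hA, hB, sum_range_succ]
  unfold cbin
  constructor
  · field_simp
    linarith
  · field_simp
    ring

/-- Even degree `d = 2k+2`: `A_q = (4^k + ½C(2k+1,k+1))/2^{2k+1}`, `B_q = (4^k − ½C(2k+1,k))/2^{2k+1}`,
hence `A_q + B_q = 1` and `A_q − B_q = 4^{-(k+1)} C(2k+2,k+1)`. [cite: HirvonenRybickiSchmidSuomela2017,
§1.3 eq. (1) with §2.4 Lemma 2 / Hastings2019BoundedDepth §3.3] -/
theorem hastings_shearer_even (k : ℕ) :
    hastingsA (2 * k + 2) (shearerQ (2 * k + 2)) + hastingsB (2 * k + 2) (shearerQ (2 * k + 2)) = 1 ∧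
    hastingsA (2 * k + 2) (shearerQ (2 * k + 2)) - hastingsB (2 * k + 2) (shearerQ (2 * k + 2)) =
      cbin (k + 1) := by
  have hq : ∀ n, shearerQ (2 * k + 2) n =
      (if n < k + 1 then 1 else 0) + (if n = k + 1 then 1 / 2 else 0) := by
    intro n
    unfold shearerQ
    by_cases h : n < k + 1
    · rw [if_pos (by omega), if_pos h, if_neg (by omega)]; ring
    · by_cases h' : n = k + 1
      · rw [if_neg (by omega), if_pos (by omega), if_neg h, if_pos h']; ring
      · rw [if_neg (by omega), if_neg (by omega), if_neg h, if_neg h']; ring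
  have hhalf : ∑ n ∈ range (k + 1), ((2 * k + 1).choose n : ℝ) = 4 ^ k := by
    exact_mod_cast Nat.sum_range_choose_halfway k
  have hsym : ((2 * k + 1).choose (k + 1) : ℝ) = ((2 * k + 1).choose k : ℝ) := by
    exact_mod_cast Nat.choose_symm_half k
  have hpas : (((2 * (k + 1)).choose (k + 1) : ℕ) : ℝ) = 2 * ((2 * k + 1).choose k : ℝ) := by
    rw [show 2 * (k + 1) = (2 * k + 1) + 1 by ring, Nat.choose_succ_succ', Nat.cast_add, hsym]
    ring
  have hA : hastingsA (2 * k + 2) (shearerQ (2 * k + 2)) =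
      (4 ^ k + ((2 * k + 1).choose k : ℝ) / 2) / 2 ^ (2 * k + 1) := by
    unfold hastingsA
    rw [show 2 * k + 2 - 1 = 2 * k + 1 by omega]
    congr 1
    simp_rw [hq, mul_add, mul_ite, mul_one, mul_zero, sum_add_distrib]
    rw [← sum_filter, sum_ite_eq' (range (2 * k + 2)), if_pos (mem_range.2 (by omega))]
    have hf : (range (2 * k + 2)).filter (fun n => n < k + 1) = range (k + 1) := by
      ext n; simp only [mem_filter, mem_range]; omega
    rw [hf, hhalf, hsym]
    ring
  have hB : hastingsB (2 * k + 2) (shearerQ (2 * k + 2)) =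
      (4 ^ k - ((2 * k + 1).choose k : ℝ) / 2) / 2 ^ (2 * k + 1) := by
    unfold hastingsB
    rw [show 2 * k + 2 - 1 = 2 * k + 1 by omega]
    congr 1
    simp_rw [hq, mul_add, mul_ite, mul_one, mul_zero, sum_add_distrib]
    rw [← sum_filter]
    have hf : (range (2 * k + 2)).filter (fun n => n + 1 < k + 1) = range k := by
      ext n; simp only [mem_filter, mem_range]; omega
    have he : ∑ n ∈ range (2 * k + 2), (if n + 1 = k + 1 then ((2 * k + 1).choose n : ℝ) * (1 / 2) else 0)
        = ((2 * k + 1).choose k : ℝ) / 2 := by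
      rw [sum_eq_single k]
      · rw [if_pos rfl]; ring
      · intro n _ hn; rw [if_neg (by omega)]
      · intro hk; simp at hk; omega
    rw [hf, he]
    have hk : ∑ n ∈ range k, ((2 * k + 1).choose n : ℝ) = 4 ^ k - ((2 * k + 1).choose k : ℝ) := by
      rw [← hhalf, sum_range_succ]; ring
    rw [hk]
    ring
  rw [hA, hB]
  unfold cbin
  rw [hpas, pow_succ, pow_mul, show ((2 : ℝ) ^ 2) = 4 by norm_num]
  have h4 : (0 : ℝ) < 4 ^ k := by positivity
  constructor
  · field_simp; ring
  · field_simp; ring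

/-- **The exact performance of Shearer's rule** on the neighbourhood graph of degree `d ≥ 1`:
`w_𝒩 = ½ + ¼ · 4^{-⌊d/2⌋} C(2⌊d/2⌋, ⌊d/2⌋)` (Hastings' formula `½ + ¼(A_q² − B_q²)` with
`A_q + B_q = 1`, `A_q − B_q = 4^{-⌊d/2⌋}C(2⌊d/2⌋,⌊d/2⌋)`). [cite: HirvonenRybickiSchmidSuomela2017,
§1.3 eq. (1) (Shearer's rule), §2.4 Lemma 2; Hastings2019BoundedDepth §3.3] -/
theorem ngraphWeight_shearer {d : ℕ} (hd : 1 ≤ d) :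
    ngraphWeight d (shearerRule d) = 1 / 2 + cbin (d / 2) / 4 := by
  rw [ngraphWeight_eq_of_symmetric hd (shearerRule_symmetric d d), sq_sub_sq]
  obtain ⟨k, rfl | rfl⟩ := Nat.even_or_odd' d
  · obtain ⟨k, rfl⟩ : ∃ k', k = k' + 1 := ⟨k - 1, by omega⟩
    obtain ⟨h1, h2⟩ := hastings_shearer_even k
    rw [show 2 * (k + 1) = 2 * k + 2 by ring] at *
    rw [h1, h2, show (2 * k + 2) / 2 = k + 1 by omega]
    ring
  · obtain ⟨h1, h2⟩ := hastings_shearer_odd k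
    rw [h1, h2, show (2 * k + 1) / 2 = k by omega]
    ring

/-- **Shearer's bound** (as restated by HRSS): `½ + √2/(8√d) ≤ ½ + ¼·4^{-⌊d/2⌋}C(2⌊d/2⌋,⌊d/2⌋)`
for every `d ≥ 1` — via Wallis (`cbin n ≥ √(2/(π(2n+1)))`) for `d ≠ 2`, equality at `d = 2`.
[cite: HirvonenRybickiSchmidSuomela2017, §1.3 eq. (2) (“Shearer shows that the expected weight of cut
(1) is at least ½ + √2/(8√d)”)] [cite: Shearer1992, main theorem (d-regular case, as restated in
HRSS §1.3)] -/
theorem shearer_const_le {d : ℕ} (hd : 1 ≤ d) :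
    Real.sqrt 2 / (8 * Real.sqrt d) ≤ cbin (d / 2) / 4 := by
  have hdR : (0 : ℝ) < d := by exact_mod_cast hd
  rw [div_le_div_iff₀ (by positivity) (by norm_num)]
  -- `√2 · 4 ≤ cbin(d/2) · 8√d`, i.e. `√2/(2√d) ≤ cbin (d/2)`
  suffices h : Real.sqrt 2 / (2 * Real.sqrt d) ≤ cbin (d / 2) by
    rw [div_le_iff₀ (by positivity)] at h; linarith
  by_cases h2 : d = 2
  · subst h2
    have : cbin (2 / 2) = 1 / 2 := by norm_num [cbin, Nat.choose]
    rw [this, show ((2 : ℕ) : ℝ) = 2 by norm_num]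
    rw [div_le_iff₀ (by positivity)]
    have := Real.sqrt_nonneg 2
    linarith
  · have hw := sqrt_le_cbin (d / 2)
    refine le_trans ?_ hw
    have e : Real.sqrt 2 / (2 * Real.sqrt d) = Real.sqrt (2 / (4 * d)) := by
      rw [Real.sqrt_div (by norm_num), Real.sqrt_mul (by norm_num),
        show Real.sqrt 4 = 2 by rw [show (4:ℝ) = 2 ^ 2 by norm_num, Real.sqrt_sq (by norm_num)]]
    rw [e]
    refine Real.sqrt_le_sqrt ?_
    rw [div_le_div_iff₀ (by positivity) (by positivity)]
    -- `π (2(d/2)+1) ≤ 4 d` for `d ≥ 1`, `d ≠ 2`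
    have hπ := Real.pi_lt_d2
    obtain ⟨k, rfl | rfl⟩ := Nat.even_or_odd' d
    · have hk : (2 : ℝ) ≤ k := by
        have : 2 ≤ k := by omega
        exact_mod_cast this
      rw [show 2 * k / 2 = k by omega]
      push_cast
      nlinarith
    · rw [show (2 * k + 1) / 2 = k by omega]
      push_cast
      nlinarith


/-- Shearer's bound with the exact value: `½ + √2/(8√d) ≤ ½ + ¼·cbin ⌊d/2⌋`. [cite:
HirvonenRybickiSchmidSuomela2017, §1.3 eq. (2)] [cite: Shearer1992, main theorem (d-regular case,
as restated in HRSS §1.3)] -/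
theorem shearer_bound_le_exact {d : ℕ} (hd : 1 ≤ d) :
    1 / 2 + Real.sqrt 2 / (8 * Real.sqrt d) ≤ 1 / 2 + cbin (d / 2) / 4 := by
  linarith [shearer_const_le hd]

/-! ## Graph level: every `d`-regular triangle-free graph -/

section Graph

variable {V : Type*} [Fintype V] [DecidableEq V] (G : _root_.SimpleGraph V) [DecidableRel G.Adj]

omit [DecidableEq V] in
/-- A regular graph with an edge has positive degree (plumbing). [folklore] -/
private theorem one_le_of_edge {d : ℕ} (hreg : G.IsRegularOfDegree d) (hE : G.edgeFinset.Nonempty) :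
    1 ≤ d := by
  obtain ⟨e, he⟩ := hE
  revert he
  refine Sym2.ind (fun a b => ?_) e
  intro he
  have hab : G.Adj a b := by simpa using he
  rw [← hreg.degree_eq a, ← G.card_neighborFinset_eq_degree]
  exact card_pos.2 ⟨b, (G.mem_neighborFinset a b).2 hab⟩

/-- **The expected cut weight of Shearer's algorithm on a `d`-regular triangle-free graph with an
edge is exactly `½ + ¼·4^{-⌊d/2⌋}C(2⌊d/2⌋,⌊d/2⌋)`** (HRSS Lemma 2 transports the neighbourhood-graph
value). [cite: HirvonenRybickiSchmidSuomela2017, §1.3 eq. (1) and §2.4 Lemma 2] -/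
theorem expCutWeight_shearer {d : ℕ} (hreg : G.IsRegularOfDegree d) (hG : G.CliqueFree 3)
    (hE : G.edgeFinset.Nonempty) :
    expCutWeight G (shearerRule d) = 1 / 2 + cbin (d / 2) / 4 := by
  rw [expCutWeight_eq G hreg hG hE, ngraphWeight_shearer (one_le_of_edge G hreg hE)]

/-- **The expected number of cut edges of Shearer's algorithm is `(½ + ¼·cbin ⌊d/2⌋)·|E|`** on every
`d`-regular triangle-free graph, `d ≥ 1`. [cite: HirvonenRybickiSchmidSuomela2017, §1.3 eq. (1) and
§2.4 Lemma 2] -/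
theorem expCutCount_shearer {d : ℕ} (hd : 1 ≤ d) (hreg : G.IsRegularOfDegree d)
    (hG : G.CliqueFree 3) :
    expCutCount G (shearerRule d) = #G.edgeFinset * (1 / 2 + cbin (d / 2) / 4) := by
  rw [expCutCount_eq G hreg hG, ngraphWeight_shearer hd]

/-- **Shearer 1992 (as restated by HRSS §1.3): on every `d`-regular triangle-free graph Shearer's
algorithm finds a cut of expected weight at least `½ + √2/(8√d) ≈ ½ + 0.177/√d`.** [cite:
HirvonenRybickiSchmidSuomela2017, §1.3 eq. (2) (“Shearer shows that the expected weight of cut (1)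
is at least ½ + √2/(8√d) in d-regular triangle-free graphs”)] [cite: Shearer1992, main theorem
(d-regular case, as restated in HRSS §1.3)] -/
theorem shearer_expCutWeight_ge {d : ℕ} (hreg : G.IsRegularOfDegree d) (hG : G.CliqueFree 3)
    (hE : G.edgeFinset.Nonempty) :
    1 / 2 + Real.sqrt 2 / (8 * Real.sqrt d) ≤ expCutWeight G (shearerRule d) := by
  rw [expCutWeight_shearer G hreg hG hE]
  exact shearer_bound_le_exact (one_le_of_edge G hreg hE)

/-- Counted form: `𝔼[#cut edges] ≥ (½ + √2/(8√d))·|E|`, `d ≥ 1`. [cite: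
HirvonenRybickiSchmidSuomela2017, §1.3 eq. (2)] [cite: Shearer1992, main theorem (d-regular case)] -/
theorem shearer_expCutCount_ge {d : ℕ} (hd : 1 ≤ d) (hreg : G.IsRegularOfDegree d)
    (hG : G.CliqueFree 3) :
    #G.edgeFinset * (1 / 2 + Real.sqrt 2 / (8 * Real.sqrt d)) ≤ expCutCount G (shearerRule d) := by
  rw [expCutCount_shearer G hd hreg hG]
  exact mul_le_mul_of_nonneg_left (shearer_bound_le_exact hd) (Nat.cast_nonneg _)

/-- **Existence corollary: every `d`-regular triangle-free graph (`d ≥ 1`) has a bipartite subgraph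
with at least `(½ + √2/(8√d))·|E|` edges** — the `d`-regular case of Shearer's theorem (the general
form `m/2 + (1/(8√2)) Σ_v √d_v` over all triangle-free graphs is NOT formalised here).
-- TODO(general form): Shearer's degree-sequence bound for arbitrary triangle-free graphs.
[cite: Shearer1992, main theorem (d-regular case, as restated in HirvonenRybickiSchmidSuomela2017
§1.3 eq. (2) and Abstract: “Shearer (1992) gives a randomised algorithm that finds a cut of expected
size (1/2 + 0.177/√d)m”)] -/
theorem shearer_exists_cut {d : ℕ} (hd : 1 ≤ d) (hreg : G.IsRegularOfDegree d)
    (hG : G.CliqueFree 3) :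
    ∃ c : V → Bool, (#G.edgeFinset : ℝ) * (1 / 2 + Real.sqrt 2 / (8 * Real.sqrt d)) ≤ cutCount G c := by
  obtain ⟨c, hc⟩ := exists_cutCount_ge G hreg hG (shearerRule d)
  rw [ngraphWeight_shearer hd] at hc
  exact ⟨c, (mul_le_mul_of_nonneg_left (shearer_bound_le_exact hd) (Nat.cast_nonneg _)).trans hc⟩

/-- The printed one-round constants side by side: Shearer's `√2/8 = 0.1767…` is below HRSS
Theorem 4's `9/32 = 0.28125`, which is below the level-1 QAOA constant `0.3032` (WHJR / Hastings §3).
[cite: HirvonenRybickiSchmidSuomela2017, Abstract (“Shearer (1992) … (1/2 + 0.177/√d)m … We give a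
simpler algorithm that does much better: … (1/2 + 0.28125/√d)m”)] -/
theorem shearer_lt_hrss_lt_qaoa : Real.sqrt 2 / 8 < 9 / 32 ∧ (9 : ℝ) / 32 < 0.3032 := by
  refine ⟨?_, by norm_num⟩
  rw [div_lt_div_iff₀ (by norm_num) (by norm_num)]
  have : Real.sqrt 2 < 3 / 2 := by
    rw [Real.sqrt_lt' (by norm_num)]; norm_num
  linarith

end Graph

end Literature.Combinatorics.SimpleGraph.ShearerTriangleFreeCut
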